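import Literature.Combinatorics.Sahi2008.FixedCycle

/-!
# Sahi's `E_n` of a SUB-family and its block-peeling recursion over subsets (the exponential formula behind Lieb–Sahi's Prop. 3.4)

Support file (cell `prim-sahi`, seat `prim-sahi-typer` gen 30; `--supports stmt-CriticalPhenomena-4575`).  Pure proofs + one definition; standard
axioms, no `sorry`.  First piece of the ORDER-10 interpolation certificate on `{0,1}^5` (…`SahiInterp*`): the grid values of `E_n` are computed by a
dynamic programme over the `2^n` sub-families, and this file is its specification.

* `csW μ f W` — Sahi's functional of the sub-family `(f_j)_{j ∈ W}`, `W ⊆ Fin n` (Lieb–Sahi's Definition 3.1 over the index type `↥W`,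
  `CycleForm.cycleSum`); `csW_univ` — for `W = univ` it is the tree's `sahiE μ n f` (`n ≥ 1`);
* **`csW_rec`** — for `v ∈ W`:
  `csW W = Σ_{B ⊆ W, v ∈ B} (|B| − 1)! · E(Π_{j∈B} f_j) · (1 if B = W, else −csW (W ∖ B))`,
  the block expansion of `E` along the cycle through `v` [LiebSahi2021, Prop. 3.4 and p. 8] = the tree's `CycleForm.cycleSum_eq_sum_blocks` on the
  index type `↥W`, with the blocks re-indexed as subsets of `W` and the complementary factor `coRest` identified with `−csW (W ∖ B)`
  (`cycleSum_comp_equiv`).  Iterating it from `W = univ` downwards evaluates `E_n` with `Σ_W 2^{|W|−1} ≈ 3^n/2` multiply–adds. [this work]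
-/

noncomputable section

namespace Summit.CriticalPhenomena.PercolationContinuityZ3.Theorems.SahiInterp

open Finset Function
open Literature.Combinatorics.Sahi2008 Literature.Combinatorics.Sahi2008.CycleForm

variable {α : Type*} [Fintype α] {n : ℕ}

/-- **Sahi's functional of the sub-family `(f_j)_{j ∈ W}`** (cycle form over the index type `↥W`; independent of any enumeration). [this work] -/
def csW (μ : α → ℝ) (f : Fin n → α → ℝ) (W : Finset (Fin n)) : ℝ :=
  cycleSum μ (fun j : W => f j)

/-- For the full index set, `csW` is the tree's `E_n` (`n ≥ 1`). [this work] -/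
theorem csW_univ (μ : α → ℝ) (hn : 1 ≤ n) (f : Fin n → α → ℝ) : csW μ f univ = sahiE μ n f := by
  unfold csW
  rw [sahiE_eq_cycleSum μ hn]
  let e : ↥(univ : Finset (Fin n)) ≃ Fin n :=
    { toFun := fun j => j.1
      invFun := fun i => ⟨i, mem_univ i⟩
      left_inv := fun j => by ext; rfl
      right_inv := fun i => rfl }
  have h := cycleSum_comp_equiv μ e f
  exact h

/-- The complement of a block inside `↥W` is the subtype of `W ∖ B`. [this work] -/
def complEquiv (W : Finset (Fin n)) (B' : Finset W) :
    {x : W // x ∉ B'} ≃ ↥(W \ B'.map (Embedding.subtype _)) where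
  toFun x := ⟨x.1.1, mem_sdiff.2 ⟨x.1.2, fun h => by
    obtain ⟨b, hb, hbx⟩ := mem_map.1 h
    exact x.2 (by rwa [← Subtype.ext hbx])⟩⟩
  invFun y := ⟨⟨y.1, (mem_sdiff.1 y.2).1⟩, fun h => (mem_sdiff.1 y.2).2 (mem_map.2 ⟨_, h, rfl⟩)⟩
  left_inv x := by ext; rfl
  right_inv y := by ext; rfl

/-- Blocks of `↥W` as subsets of `W` and back. [this work] -/
theorem subtype_map_val (W : Finset (Fin n)) (B' : Finset W) :
    (B'.map (Embedding.subtype _)).subtype (· ∈ W) = B' := by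
  ext a
  rw [mem_subtype, mem_map]
  constructor
  · rintro ⟨b, hb, hba⟩
    rwa [← Subtype.ext hba]
  · intro ha
    exact ⟨a, ha, rfl⟩

/-- The whole of `↥W` maps to `W`. [this work] -/
theorem univ_map_val (W : Finset (Fin n)) : (univ : Finset W).map (Embedding.subtype _) = W := by
  ext a
  rw [mem_map]
  constructor
  · rintro ⟨b, -, rfl⟩
    exact b.2
  · intro ha
    exact ⟨⟨a, ha⟩, mem_univ _, rfl⟩

/-- **THE BLOCK-PEELING RECURSION** (exponential formula / Lieb–Sahi Prop. 3.4 along the cycle through `v`): for `v ∈ W`,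
`csW W = Σ_{B ⊆ W, v ∈ B} (|B|−1)!·E(Π_{j∈B} f_j)·(1 if B = W else −csW (W ∖ B))`. [this work] -/
theorem csW_rec (μ : α → ℝ) (f : Fin n → α → ℝ) {W : Finset (Fin n)} {v : Fin n} (hv : v ∈ W) :
    csW μ f W = ∑ B ∈ W.powerset.filter (fun B => v ∈ B),
      ((B.card - 1).factorial : ℝ) * (ex μ (fun x => ∏ j ∈ B, f j x) * (if B = W then 1 else -csW μ f (W \ B))) := by
  unfold csW
  rw [cycleSum_eq_sum_blocks μ (fun j : W => f j) ⟨v, hv⟩]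
  refine Finset.sum_nbij' (fun B' => B'.map (Embedding.subtype _)) (fun B => B.subtype (· ∈ W)) ?_ ?_ ?_ ?_ ?_
  · intro B' hB'
    rw [mem_filter] at hB' ⊢
    refine ⟨mem_powerset.2 fun a ha => ?_, mem_map.2 ⟨_, hB'.2, rfl⟩⟩
    obtain ⟨b, -, rfl⟩ := mem_map.1 ha
    exact b.2
  · intro B hB
    rw [mem_filter] at hB ⊢
    exact ⟨mem_univ _, mem_subtype.2 hB.2⟩
  · intro B' _
    exact subtype_map_val W B'
  · intro B hB
    rw [mem_filter, mem_powerset] at hB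
    rw [subtype_map, filter_true_of_mem fun a ha => hB.1 ha]
  · intro B' _
    have hprod : (fun x => ∏ j ∈ B'.map (Embedding.subtype (· ∈ W)), f j x) = fun x => ∏ j ∈ B', f (j : Fin n) x := by
      funext x
      rw [prod_map]
      rfl
    rw [card_map, hprod]
    congr 2
    by_cases hBW : B' = univ
    · subst hBW
      rw [coRest_univ, univ_map_val, if_pos rfl]
    · have hne : B'.map (Embedding.subtype _) ≠ W := by
        intro h
        apply hBW
        apply map_injective (Embedding.subtype (· ∈ W))
        rw [h, univ_map_val]
      rw [coRest_of_ne_univ μ _ hBW, if_neg hne,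
        ← cycleSum_comp_equiv μ (complEquiv W B') (fun j : ↥(W \ B'.map (Embedding.subtype (· ∈ W))) => f j)]
      rfl

end Summit.CriticalPhenomena.PercolationContinuityZ3.Theorems.SahiInterp
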